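import Mathlib
import Summits.ValiantsHypothesis.ValiantsHypothesis.Theorems.NewtonUnitEquationsTwoProductsFormalLogLinearisationPlanarCellTransfer
import Summits.ValiantsHypothesis.ValiantsHypothesis.Theorems.NewtonUnitEquationsTwoProductsFormalLogLinearisationLogSumEngineOne
import HarnessLib

/-!

**STATUS 2026-08-28T02:45Z — LINE DEAD AT SUB₂.** `stub_planarSlotBound` (SUB₂, t-free slot count) is FALSE: val-lit p3 g13's explicit m = 2 ghost-pair staircase (one weight-order cell with K+1 visible corners q_k = f_k + f'_{K−k}, each with a cross rep of slot exponent 1, ∀ K; t − 1 = (K+1)(K+4)/2; RULING #131; Negative file `Theorems/TwoProducts/Negative/PlanarSlotBoundFalse.lean` in progress by p3). What survives: the proved reduction `planarCellBound_of`/`TwoProducts_of` (true, but its t-free cell bound is unattainable), SUB₁ `PlanarCross` (alive; prove-only at fixed m since cost ≤ 2^m identically — crit-3 VERDICT #1), `quasiPolyCell_of_planarCross`, the m = 1 bodies, and the rung `Lines/planar_cell_rung.lean` (both SUB bodies with value 2m below the first additive coincidence). Autopsy: `Lines/planar_cell.dead.md`. v2 of this file only fixes a lint (unused simp argument) and adds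 this note; statements unchanged (SUB₂ kept verbatim as the negation target).
# Crux `TwoProducts` (stmt-ValiantsHypothesis-5906) — line `planar_cell` (ideator val-idea-8, lens = decomp)

Route `NewtonUnitEquations` (crux r3 `TwoProducts`; shared aside of `NewtonFrames`).  A D-0145 LINE: a Lean skeleton
targeting the EXISTING decl `Summit.ValiantsHypothesis.ValiantsHypothesis.Theses.NewtonUnitEquations.TwoProducts` BY NAME
(`TwoProducts_of`, kernel-checked, no `sorry` of its own) through the LANDED reduction
`FormalLogLinearisation.twoProducts_of_planarCellBound` (p596451, val-lit p3 g12): the crux is the log-sum engine on ONE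
weight-order cell of the tail support (`PlanarCellBound`, restated verbatim below), and this file PROVES the split

  **`PlanarCross → PlanarSlotBound → PlanarCellBound`**   (`planarCellBound_of`, no `sorry`),

with exactly TWO registered stubs `stub_planarCross` (SUB₁) and `stub_planarSlotBound` (SUB₂, the hardest), both OPEN.
HONEST FRAME: nothing is claimed — SUB₁, SUB₂, `PlanarCellBound`, `stub_logSumEngine`, the crux `TwoProducts` and the
route stay OPEN; `VP ≠ VNP` is NOT proved and NOT moved by this file.  bears_on: V-crux stmt-ValiantsHypothesis-5906
(line proposal; no rung moves).  Critic gate: val-idea-crit-3 before any prover.  NOT `skeleton check`ed by the ideator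
(registration is the desk's / operator's call).

## The decomposition (why THIS cut)

The lifted necessary condition `liftedPencilCount` (p595517) is proved by SWEEP × (CROSS, SHAPES, SLOTS, INJECTIVITY)
(`ExpSum.pencilCount` = `pencilOrder_classes` × `ExpSum.pencilCount_cell`; the cell count = `hyperbolicCross` /
`card_support_le_log` for shapes, `slotRank_card_le` for slots, and an injectivity-within-a-shape argument).  Going
planar (`[D]_λ = Σ_{Λμ = λ} w(μ)·G(μ)`, fibre sums of the unequal-moment function over the exponent map
`Λ = Λ_E : ℕ^E → ℕ²`, theory memo §3) the SWEEP transfers verbatim (p596451) and — proved HERE, `planarCount_cell` —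
so do SHAPES and INJECTIVITY: two cell-visible points whose representatives differ only in their slot-0 coordinate
`j ≠ j'` have planar images differing by `e·(E_j − E_{j'})`, whose weight has a constant sign on the cell, so the heavier
image refutes the strict top of the other (this uses only that visible points are ALIVE planar points; no fibre
structure).  What does NOT transfer are precisely the two inputs whose lifted proofs use `G ≠ 0` AT A SINGLE LIFTED
POINT — the box-character shift of `hyperbolicCross` and the Hankel factorisation of `slotRank_card_le` both die on
fibre mates (alive-but-cancelled points).  The split names them as planar statements:

* **SUB₁ `PlanarCross`** (memo Q1, typed; `t`-free): every visible point of `supp D` has a decomposition over the tail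
  support with `∏_e (μ_e + 1) ≤ (2m)^c`.  ALONE it already yields a quasi-polynomial cell bound
  (`quasiPolyCell_of_planarCross`, proved: `(L+1)·n^L·(2mt)^L`, `n = (2m)^c`, `L = log₂ n`).
* **SUB₂ `PlanarSlotBound`** (NOTE §12's fibre-sum RANK step, typed as a `t`-FREE COUNT — rank-free, so no linear
  algebra is presupposed): in one cell, coordinates occupying a fixed slot (exponent `e ≥ 1`) of cross-representatives
  of pairwise DISTINCT visible points number `≤ (2m)^{c'}`.  This is where `m`-uniformity must bite.

Glue constants: cell bound `2^{9c(1+c+c')·m}·(t+2)^0` (`cell_arith`), then p596451's `(a+7, b+3)` and p585696's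
`(a+5, b+3)` inside `twoProducts_of_planarCellBound`.

CALIBRATION (proved here): both stubs' bodies hold at `m = 1` (`planarCross_one`, `planarSlotBound_one`, via
`…LogSumEngineOne.logVisible_subset_support_sub` and the all-`m` lemma `eq_of_visible_mem_tailSupport`: a cell family
contains AT MOST ONE tail exponent).  Paper calibration (line card §Rungs): both bodies hold with `c = c' = 1` (values
`2m`) (i) in the dissociated regime (singleton fibres: they ARE `hyperbolicCross` / `slotRank_card_le`) and (ii) on the
GENERIC TORUS-TWIST families of Disproof F7 / `…TorusTwist.lean` (there `[D]_λ = r(λ)·Φ(λ)` with `Φ∘Λ` a lifted `2m`-term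
exponential sum CONSTANT ON FIBRES, so after a generic tie-break of the grading a vertex of the fibre is a strict
lifted minimiser and the lifted lemmas apply) — the two extreme regimes of the memo; the open middle is partial toric
alignment (memo Q1′/Q2′).

## Why this line is not one of the listed ones (novelty, problem-relative)

* vs the registered line `formal-log-linearisation` (`stub_logSumEngine`, one XL stub) and p3's `PlanarCellBound`
  (its one-cell restriction, now the TARGET of this file): this line cuts the remaining stub into two typed, `t`-free,
  single-cell statements with a proved recombination; neither piece is the target reworded (SUB₁ is structural and not
  implied by `PlanarCellBound`; SUB₂'s `t`-free bound is not implied by it either; conversely neither piece alone gives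
  it — SUB₁ alone gives only the quasi-polynomial bound above).
* vs `corner-log-linearization` / `mahler-radix-recursion` / `FrameRungTwo` (other lines of this crux): no fibre /
  lifted-coordinate object there.
* Prior art searched (2026-08-28): corpus `lit search --hybrid "Newton polygon of product of sparse polynomials number of
  vertices tau conjecture"` / `"support of logarithm of sparse polynomial power sums multinomial fibre cancellation"` —
  no relevant hit beyond citations of KPTT [corpus:paper:arxiv-1503.07705 p.5 Thm 5; paper:arxiv-1806.00417 p.18];
  galaxy `"conjecture for Newton polygons|Newton polygons of products" --star all` → KPTT slides
  [galaxy:pdf:2253161143473960600], arXiv:1308.2286 (the route's Literature anchor `NewtonPolygonTau`).  No hyperbolic-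
  cross / slot-count statement for supports of logarithms of sparse polynomials found in print.  Delta: the typed planar
  cross + slot count and their proved recombination are new relative to the tree and (as far as searched) to print.

## Cheapest falsifiers (critic first)

* SUB₁: ONE cascade instance (`m ∈ {2,3}`, tail exponents with additive relations, planted fibre cancellation — memo
  K4/Q1 recipe, `val-width-0318-p2/planar_q1.py`: 0 violations of `∏ ≤ 2m` in ≈ 835 instances so far) exhibiting a
  visible point all of whose decompositions have `∏(μ_e+1) > (2m)^c` for growing `c`; INSTRUMENT row: kit job
  `planar_split_census` (this seat; id in the line card) records `max_λ min_fibre ∏(μ+1) / 2m` per instance.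
* SUB₂: in the same instances, a cell and a slot with more than `2m` (then `(2m)^2`, …) coordinates among cross
  representatives of distinct visible points; INSTRUMENT: same job, column `max_slot_width / 2m`.
* In-Lean: none cheap (both stubs quantify over all tails); the `m = 1` bodies are theorems below.

## Disproof used (`Cruxes/TwoProducts/Disproof.lean`)

* `twoProducts_false_without_sparsityF/G` — HONOURED upstream: sparsity of both tails enters only through
  `#tail support ≤ 2mt` in p596451's sweep (number of cells); SUB₁/SUB₂ are sparsity-free BY DESIGN (per-cell, `t`-free),
  which is consistent with `not_twoProductsBoundFreeOfT` (the `t`-dependence lives in the cell count, exactly as in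
  `liftedPencilCount`).
* `not_twoProductsBoundFreeOfM` (q-Pochhammer, `t = 2`) — HONOURED: the cell bound keeps `2^{O(m)}`; monomial tails are
  the rays regime (`stub_raysRung`, landed) and satisfy SUB₁/SUB₂ with values `2`, `1`.
* §3 F4 (rank) is SUB₂'s lifted shadow; F5 (generic exponents) = the dissociated calibration; F7 (torus twists) =
  the second calibration above; F9 `FirstOrderCount` is NOT assumed.  No landed Negative lemma refutes an instance of
  either stub (the Negative files contain no statement about decompositions or slots).  `-- Targets`: none on this line.
-/

noncomputable section

set_option linter.dupNamespace false

open scoped BigOperators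
open MvPolynomial
open Summit.ValiantsHypothesis.ValiantsHypothesis.Theorems.NewtonUnitEquations.TwoProducts.FormalLogLinearisation

namespace Summit.ValiantsHypothesis.ValiantsHypothesis.Cruxes.TwoProducts.PlanarCell

/-! ## Objects -/

/-- Planar image `Λ_E(μ) = Σ_i μ_i • E_i` of a lifted multi-index `μ : Fin s → ℕ` along an enumeration `E` of tail
exponents (the monoid map `ℕ^E → ℕ²` of the theory memo §3). -/
def lam {s : ℕ} (E : Fin s → Expo) (μ : Fin s → ℕ) : Expo := ∑ i, μ i • E i

variable {m : ℕ}

/-- The tail support `⋃_j supp u_j ∪ ⋃_j supp v_j` (verbatim the inline set of `twoProducts_of_planarCellBound`). -/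
def tailSupport (u v : Fin m → MvPolynomial (Fin 2) ℂ) : Finset Expo :=
  (Finset.univ.biUnion fun j => (u j).support) ∪ Finset.univ.biUnion fun j => (v j).support

/-! ## Elementary lemmas on weights and planar images -/

theorem wt_add (ξ : Fin 2 → ℝ) (a b : Expo) : wt ξ (a + b) = wt ξ a + wt ξ b := by
  simp only [wt, Finsupp.coe_add, Pi.add_apply, Nat.cast_add]
  ring

theorem wt_nsmul (ξ : Fin 2 → ℝ) (k : ℕ) (a : Expo) : wt ξ (k • a) = (k : ℝ) * wt ξ a := by
  simp only [wt, Finsupp.coe_smul, Pi.smul_apply, smul_eq_mul, Nat.cast_mul]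
  ring

theorem wt_zero (ξ : Fin 2 → ℝ) : wt ξ 0 = 0 := by simp [wt]

theorem wt_sum {ι : Type*} (ξ : Fin 2 → ℝ) (S : Finset ι) (g : ι → Expo) :
    wt ξ (∑ i ∈ S, g i) = ∑ i ∈ S, wt ξ (g i) := by
  classical
  induction S using Finset.induction_on with
  | empty => simp [wt_zero]
  | insert a S ha ih => rw [Finset.sum_insert ha, Finset.sum_insert ha, wt_add, ih]

/-- `wt ξ (Λ_E μ) = Σ_i μ_i · wt ξ (E i)`. -/
theorem wt_lam {s : ℕ} (ξ : Fin 2 → ℝ) (E : Fin s → Expo) (μ : Fin s → ℕ) :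
    wt ξ (lam E μ) = ∑ i, (μ i : ℝ) * wt ξ (E i) := by
  unfold lam
  rw [wt_sum]
  exact Finset.sum_congr rfl fun i _ => wt_nsmul ξ (μ i) (E i)

/-- `Λ_E (ρ + e·e_j) = Λ_E ρ + e • E_j`. -/
theorem lam_add_single {s : ℕ} (E : Fin s → Expo) (ρ : Fin s → ℕ) (j : Fin s) (e : ℕ) :
    lam E (ρ + (Pi.single j e : Fin s → ℕ)) = lam E ρ + e • E j := by
  classical
  unfold lam
  simp only [Pi.add_apply, add_smul, Finset.sum_add_distrib]
  congr 1
  rw [Finset.sum_eq_single j]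
  · simp
  · intro i _ hi; simp [hi]
  · intro h; exact absurd (Finset.mem_univ j) h

set_option linter.unnecessarySimpa false in
/-- `Λ_E (e_j) = E_j`. -/
theorem lam_single {s : ℕ} (E : Fin s → Expo) (j : Fin s) :
    lam E (Pi.single j 1 : Fin s → ℕ) = E j := by
  have := lam_add_single E 0 j 1
  simpa [lam] using this

/-- Cancelling a positive scalar on exponent vectors. -/
theorem eq_of_nsmul_eq {e : ℕ} (he : 1 ≤ e) {a b : Expo} (h : e • a = e • b) : a = b := by
  ext i
  have := congrArg (fun f : Expo => f i) h
  simp only [Finsupp.coe_smul, Pi.smul_apply, smul_eq_mul] at this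
  exact Nat.eq_of_mul_eq_mul_left (by omega) this

/-- Support size from the cross condition: `2^{#supp μ} ≤ ∏ (μ_i + 1) ≤ n` gives `#supp μ ≤ log₂ n`. -/
theorem card_support_le_log_of_prod_le {s : ℕ} (μ : Fin s → ℕ) (n : ℕ) (h : ∏ i, (μ i + 1) ≤ n) :
    (Finset.univ.filter fun i => μ i ≠ 0).card ≤ Nat.log 2 n := by
  classical
  have hpow : 2 ^ (Finset.univ.filter fun i => μ i ≠ 0).card ≤ ∏ i, (μ i + 1) := by
    calc 2 ^ (Finset.univ.filter fun i => μ i ≠ 0).card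
        = ∏ i ∈ Finset.univ.filter (fun i => μ i ≠ 0), 2 := by simp
      _ ≤ ∏ i ∈ Finset.univ.filter (fun i => μ i ≠ 0), (μ i + 1) := by
          refine Finset.prod_le_prod' fun i hi => ?_
          have := (Finset.mem_filter.mp hi).2
          omega
      _ ≤ ∏ i, (μ i + 1) :=
          Finset.prod_le_prod_of_subset_of_one_le' (Finset.filter_subset _ _) fun i _ _ => Nat.succ_pos _
  exact Nat.le_log_of_pow_le (by norm_num) (hpow.trans h)

/-- Exponents from the cross condition: `μ_i + 1 ∣ ∏ (μ_j + 1) ≤ n` gives `μ_i < n`. -/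
theorem apply_lt_of_prod_le {s : ℕ} (μ : Fin s → ℕ) (n : ℕ) (h : ∏ i, (μ i + 1) ≤ n) (i : Fin s) : μ i < n := by
  have hdvd : (μ i + 1) ∣ ∏ j, (μ j + 1) := Finset.dvd_prod_of_mem (fun j => μ j + 1) (Finset.mem_univ i)
  have hle : μ i + 1 ≤ ∏ j, (μ j + 1) := Nat.le_of_dvd (Finset.prod_pos fun j _ => Nat.succ_pos _) hdvd
  exact Nat.lt_of_lt_of_le (Nat.lt_succ_self _) (hle.trans h)


/-! ## The abstract planar cell count (planar re-run of `ExpSum.pencilCount_cell`) -/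

/-- **PLANAR PER-CELL COUNT (abstract).**  Let `E : Fin s → ℕ²` be an injective enumeration of exponents, `N ⊆ ℕ²`
("alive" planar points), `R` a relation on coordinates, and `C` a finite set of lifted multi-indices such that every
`μ ∈ C` lies in the hyperbolic cross `∏ (μ_i + 1) ≤ n` and its planar image `Λ_E μ` is the STRICT `ξ`-top of `N` for
some weight `ξ` inducing `R` on the coordinates (`R j j' ↔ wt ξ E_j ≤ wt ξ E_{j'}`) — a CELL FAMILY of
representatives.  If every SLOT is `f`-narrow — for every `e ≥ 1`, every set `D` of coordinates carrying pairwise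
distinct representatives `rep d ∈ C` with `(rep d)_d = e` has `#D ≤ f` — then
`#C ≤ (log₂ n + 1) · n^{log₂ n} · f^{log₂ n}`.  (Shapes `≤ (log₂ n + 1) n^{log₂ n}`; within a shape a member is
determined by its slots `1, …, L−1`: two members differing only in slot `0` have planar images differing by
`e·(E_j − E_{j'})`, whose weight sign is constant on the cell, so the heavier kills the other's strict top.) -/
theorem planarCount_cell {s : ℕ} (E : Fin s → Expo) (hE : Function.Injective E) (N : Set Expo)
    (R : Fin s → Fin s → Prop) (n f : ℕ) (hf : 1 ≤ f) (C : Finset (Fin s → ℕ))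
    (hC : ∀ μ ∈ C, (∏ i, (μ i + 1)) ≤ n ∧ ∃ ξ : Fin 2 → ℝ,
      IsStrictTop ξ N (lam E μ) ∧ ∀ j j' : Fin s, R j j' ↔ wt ξ (E j) ≤ wt ξ (E j'))
    (hslot : ∀ e : ℕ, 1 ≤ e → ∀ (D : Finset (Fin s)) (rep : Fin s → (Fin s → ℕ)),
      (∀ d ∈ D, rep d ∈ C ∧ rep d d = e) → Set.InjOn rep ↑D → D.card ≤ f) :
    C.card ≤ (Nat.log 2 n + 1) * n ^ Nat.log 2 n * f ^ Nat.log 2 n := by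
  classical
  set Lm := Nat.log 2 n with hLm
  -- degenerate cases
  rcases Nat.eq_zero_or_pos n with hn0 | hnpos
  · -- `n = 0`: the cross is empty, so `C = ∅`
    have hC0 : C = ∅ := by
      refine Finset.eq_empty_of_forall_notMem fun μ hμ => ?_
      have h1 : 1 ≤ ∏ i, (μ i + 1) := Finset.prod_pos fun i _ => Nat.succ_pos _
      have h2 := (hC μ hμ).1
      omega
    simp [hC0]
  rcases Nat.eq_zero_or_pos s with hs0 | hspos
  · -- no coordinates: at most one function `Fin 0 → ℕ`
    subst hs0
    have : C.card ≤ 1 := Finset.card_le_one.2 fun μ _ μ' _ => funext fun i => i.elim0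
    calc C.card ≤ 1 := this
      _ ≤ (Lm + 1) * n ^ Lm * f ^ Lm := Nat.one_le_iff_ne_zero.2 (by positivity)
  obtain ⟨i₀⟩ : Nonempty (Fin s) := ⟨⟨0, hspos⟩⟩
  -- the witnesses
  have hC' : ∀ μ ∈ C, ∃ ξ : Fin 2 → ℝ,
      IsStrictTop ξ N (lam E μ) ∧ ∀ j j' : Fin s, R j j' ↔ wt ξ (E j) ≤ wt ξ (E j') := fun μ hμ => (hC μ hμ).2
  -- structural facts: support and exponents (from the cross condition)
  have hsupp : ∀ μ ∈ C, (Finset.univ.filter fun i => μ i ≠ 0).card ≤ Lm := fun μ hμ =>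
    card_support_le_log_of_prod_le μ n (hC μ hμ).1
  have hexp : ∀ μ ∈ C, ∀ i, μ i < n := fun μ hμ i => apply_lt_of_prod_le μ n (hC μ hμ).1 i
  -- labelling of the support: slot `l` ↦ the `l`-th coordinate of the support (increasing), junk beyond
  let supp : (Fin s → ℕ) → Finset (Fin s) := fun μ => Finset.univ.filter fun i => μ i ≠ 0
  let lab : (Fin s → ℕ) → ℕ → Fin s := fun μ l =>
    if h : l < (supp μ).card then (supp μ).orderEmbOfFin rfl ⟨l, h⟩ else i₀
  have hlab_mem : ∀ μ l, l < (supp μ).card → μ (lab μ l) ≠ 0 := by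
    intro μ l hl
    have : lab μ l ∈ supp μ := by
      simp only [lab, dif_pos hl]; exact Finset.orderEmbOfFin_mem _ _ _
    simpa [supp] using this
  have hlab_inj : ∀ μ l l', l < (supp μ).card → l' < (supp μ).card → lab μ l = lab μ l' → l = l' := by
    intro μ l l' hl hl' h
    simp only [lab, dif_pos hl, dif_pos hl'] at h
    have := ((supp μ).orderEmbOfFin rfl).injective h
    simpa using this
  have hlab_surj : ∀ μ i, μ i ≠ 0 → ∃ l, l < (supp μ).card ∧ lab μ l = i := by
    intro μ i hi
    have hi' : i ∈ supp μ := by simpa [supp] using hi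
    have : i ∈ Set.range ((supp μ).orderEmbOfFin rfl) := by
      rw [Finset.range_orderEmbOfFin]; exact hi'
    obtain ⟨⟨l, hl⟩, hl'⟩ := this
    exact ⟨l, hl, by simp only [lab, dif_pos hl]; exact hl'⟩
  -- the shape key
  let key : (Fin s → ℕ) → ℕ × (Fin Lm → ℕ) := fun μ =>
    ((supp μ).card, fun l => if (l : ℕ) < (supp μ).card then μ (lab μ l) else 0)
  have hkey_img : C.image key ⊆ (Finset.range (Lm + 1)) ×ˢ (Fintype.piFinset fun _ : Fin Lm => Finset.range n) := by
    intro k hk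
    obtain ⟨μ, hμ, rfl⟩ := Finset.mem_image.1 hk
    refine Finset.mem_product.2 ⟨Finset.mem_range.2 (Nat.lt_succ_of_le (hsupp μ hμ)), ?_⟩
    refine Fintype.mem_piFinset.2 fun l => Finset.mem_range.2 ?_
    simp only [key]
    split_ifs
    · exact hexp μ hμ _
    · exact hnpos
  have hkey_card : (C.image key).card ≤ (Lm + 1) * n ^ Lm := by
    refine (Finset.card_le_card hkey_img).trans ?_
    rw [Finset.card_product, Finset.card_range, Fintype.card_piFinset, Finset.prod_const, Finset.card_range,
      Finset.card_univ, Fintype.card_fin]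
  -- fibre bound
  have hfib : ∀ k ∈ C.image key, (C.filter fun μ => key μ = k).card ≤ f ^ Lm := by
    intro k hk
    obtain ⟨μ₀, hμ₀, rfl⟩ := Finset.mem_image.1 hk
    set L := (supp μ₀).card with hL
    set G := C.filter fun μ => key μ = key μ₀ with hG
    have hGmem : ∀ μ ∈ G, μ ∈ C ∧ (supp μ).card = L ∧ ∀ l, l < L → μ (lab μ l) = μ₀ (lab μ₀ l) := by
      intro μ hμ
      obtain ⟨hμC, hk⟩ := Finset.mem_filter.1 hμ
      have h1 : (supp μ).card = L := by simpa [key] using congrArg Prod.fst hk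
      refine ⟨hμC, h1, fun l hl => ?_⟩
      have hlLm : l < Lm := lt_of_lt_of_le hl (hL ▸ hsupp μ₀ hμ₀)
      have h2 := congrFun (congrArg Prod.snd hk) ⟨l, hlLm⟩
      simpa [key, h1, hl, ← hL] using h2
    have hLle : L ≤ Lm := hsupp μ₀ hμ₀
    -- slot sets are `f`-narrow (hypothesis `hslot`)
    have hslot' : ∀ l, l < L → (G.image fun μ => lab μ l).card ≤ f := by
      intro l hl
      set e := μ₀ (lab μ₀ l) with he
      have he1 : 1 ≤ e := Nat.one_le_iff_ne_zero.2 (hlab_mem μ₀ l (hL ▸ hl))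
      have hrepex : ∀ d ∈ G.image (fun μ => lab μ l), ∃ μ ∈ G, lab μ l = d := fun d hd => by
        simpa only [Finset.mem_image] using hd
      choose! rep hrepG hrepl using hrepex
      refine hslot e he1 _ rep (fun d hd => ⟨(hGmem _ (hrepG d hd)).1, ?_⟩) ?_
      · have := (hGmem _ (hrepG d hd)).2.2 l hl
        rw [hrepl d hd] at this
        exact this
      · intro d hd d' hd' h
        have h1 := hrepl d hd
        have h2 := hrepl d' hd'
        rw [← h1, ← h2, h]
    -- a member is determined by its slots `1, …, L-1`
    have hinj : Set.InjOn (fun μ => fun l : Fin (L - 1) => lab μ ((l : ℕ) + 1)) ↑G := by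
      intro μ hμ μ' hμ' hEq
      obtain ⟨hμC, hμL, hμσ⟩ := hGmem μ hμ
      obtain ⟨hμ'C, hμ'L, hμ'σ⟩ := hGmem μ' hμ'
      have htail : ∀ l, 1 ≤ l → l < L → lab μ l = lab μ' l := by
        intro l h1 hl
        have := congrFun hEq ⟨l - 1, by omega⟩
        simpa [Nat.sub_add_cancel h1] using this
      rcases Nat.eq_zero_or_pos L with hL0 | hLpos
      · -- empty support: both are zero
        funext i
        have h1 : μ i = 0 := by
          by_contra h
          obtain ⟨l, hl, -⟩ := hlab_surj μ i h
          omega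
        have h2 : μ' i = 0 := by
          by_contra h
          obtain ⟨l, hl, -⟩ := hlab_surj μ' i h
          omega
        rw [h1, h2]
      set j := lab μ 0 with hj
      set j' := lab μ' 0 with hj'
      set e := μ₀ (lab μ₀ 0) with he
      -- common values off `{j, j'}`
      have hval : ∀ i, i ≠ j → i ≠ j' → μ i = μ' i := by
        intro i hij hij'
        by_cases hi : μ i = 0
        · by_cases hi' : μ' i = 0
          · rw [hi, hi']
          · exfalso
            obtain ⟨l, hl, hli⟩ := hlab_surj μ' i hi'
            have hl1 : 1 ≤ l := by
              by_contra h0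
              have hl0 : l = 0 := by omega
              subst hl0
              exact hij' hli.symm
            have hlabμ : lab μ l = i := by rw [htail l hl1 (by omega), hli]
            have := hlab_mem μ l (by omega)
            rw [hlabμ] at this
            exact this hi
        · obtain ⟨l, hl, hli⟩ := hlab_surj μ i hi
          have hl1 : 1 ≤ l := by
            by_contra h0
            have hl0 : l = 0 := by omega
            subst hl0
            exact hij hli.symm
          have hli' : lab μ' l = i := by rw [← htail l hl1 (by omega), hli]
          have h1 := hμσ l (by omega)
          have h2 := hμ'σ l (by omega)
          rw [hli] at h1
          rw [hli'] at h2
          rw [h1, h2]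
      have hμj : μ j = e := hμσ 0 (by omega)
      have hμ'j' : μ' j' = e := hμ'σ 0 (by omega)
      have he1 : 1 ≤ e := by
        rw [← hμj]; exact Nat.one_le_iff_ne_zero.2 (hlab_mem μ 0 (by omega))
      -- if `j = j'` the points coincide
      by_cases hjj : j = j'
      · funext i
        by_cases hij : i = j
        · rw [hij, hμj]
          rw [hjj, hμ'j']
        · exact hval i hij (fun h => hij (h.trans hjj.symm))
      -- otherwise `μ' j = 0` and `μ j' = 0`
      have hμ'j : μ' j = 0 := by
        by_contra h
        obtain ⟨l, hl, hli⟩ := hlab_surj μ' j h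
        by_cases hl0 : l = 0
        · subst hl0
          exact hjj hli.symm
        · have hlabμ : lab μ l = lab μ 0 := by rw [htail l (by omega) (by omega), hli]
          have := hlab_inj μ l 0 (by omega) (by omega) hlabμ
          exact hl0 this
      have hμj' : μ j' = 0 := by
        by_contra h
        obtain ⟨l, hl, hli⟩ := hlab_surj μ j' h
        by_cases hl0 : l = 0
        · subst hl0
          exact hjj hli
        · have hlabμ' : lab μ' l = lab μ' 0 := by rw [← htail l (by omega) (by omega), hli]
          have := hlab_inj μ' l 0 (by omega) (by omega) hlabμ'
          exact hl0 this
      -- `μ = ρ + e e_j`, `μ' = ρ + e e_{j'}` with the common remainder `ρ`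
      set ρ : Fin s → ℕ := Function.update μ j 0 with hρ
      have hμρ : μ = ρ + (Pi.single j e : Fin s → ℕ) := by
        rw [← hμj]; exact (ExpSum.update_add_single μ j).symm
      have hμ'ρ : μ' = ρ + (Pi.single j' e : Fin s → ℕ) := by
        funext i
        by_cases hij' : i = j'
        · subst hij'
          simp [hρ, Function.update_of_ne (Ne.symm hjj), hμj', hμ'j']
        · by_cases hij : i = j
          · subst hij
            simp [hρ, hμ'j, hij']
          · simp [hρ, Function.update_of_ne hij, hij', hval i hij hij']
      -- planar images: `Λ μ = Λ ρ + e E_j`, `Λ μ' = Λ ρ + e E_{j'}`, distinct since `E` is injective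
      have hLμ : lam E μ = lam E ρ + e • E j := by rw [hμρ, lam_add_single]
      have hLμ' : lam E μ' = lam E ρ + e • E j' := by rw [hμ'ρ, lam_add_single]
      have hne : lam E μ ≠ lam E μ' := by
        intro h
        rw [hLμ, hLμ'] at h
        have h' : e • E j = e • E j' := add_left_cancel h
        exact hjj (hE (eq_of_nsmul_eq he1 h'))
      obtain ⟨ξ, hvis, hR⟩ := hC' μ hμC
      obtain ⟨ξ', hvis', hR'⟩ := hC' μ' hμ'C
      have hNμ : lam E μ ∈ N := hvis.1
      have hNμ' : lam E μ' ∈ N := hvis'.1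
      have hwμ : ∀ ζ : Fin 2 → ℝ, wt ζ (lam E μ) = wt ζ (lam E ρ) + (e : ℝ) * wt ζ (E j) := fun ζ => by
        rw [hLμ, wt_add, wt_nsmul]
      have hwμ' : ∀ ζ : Fin 2 → ℝ, wt ζ (lam E μ') = wt ζ (lam E ρ) + (e : ℝ) * wt ζ (E j') := fun ζ => by
        rw [hLμ', wt_add, wt_nsmul]
      exfalso
      have hepos : (0 : ℝ) ≤ (e : ℝ) := by positivity
      rcases le_total (wt ξ' (E j')) (wt ξ' (E j)) with hle | hle
      · -- at `ξ'`, `Λ μ` is at least as heavy as `Λ μ'`: contradicts the strict top `Λ μ'`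
        have hlt := hvis'.2 (lam E μ) hNμ hne
        have := mul_le_mul_of_nonneg_left hle hepos
        rw [hwμ ξ', hwμ' ξ'] at hlt
        linarith
      · -- `R j j'`, so at `ξ` too `wt E_j ≤ wt E_{j'}`: `Λ μ'` is at least as heavy as `Λ μ` at `ξ`
        have hle' : wt ξ (E j) ≤ wt ξ (E j') := (hR _ _).1 ((hR' _ _).2 hle)
        have hlt := hvis.2 (lam E μ') hNμ' (Ne.symm hne)
        have := mul_le_mul_of_nonneg_left hle' hepos
        rw [hwμ ξ, hwμ' ξ] at hlt
        linarith
    -- count the fibre through the injection into `∏_{l < L-1} (slot set l+1)`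
    have himg : G.image (fun μ => fun l : Fin (L - 1) => lab μ ((l : ℕ) + 1)) ⊆
        Fintype.piFinset fun l : Fin (L - 1) => G.image fun μ => lab μ ((l : ℕ) + 1) := by
      intro g hg
      obtain ⟨μ, hμ, rfl⟩ := Finset.mem_image.1 hg
      exact Fintype.mem_piFinset.2 fun l => Finset.mem_image_of_mem _ hμ
    calc G.card = (G.image fun μ => fun l : Fin (L - 1) => lab μ ((l : ℕ) + 1)).card :=
          (Finset.card_image_of_injOn hinj).symm
      _ ≤ (Fintype.piFinset fun l : Fin (L - 1) => G.image fun μ => lab μ ((l : ℕ) + 1)).card :=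
          Finset.card_le_card himg
      _ = ∏ l : Fin (L - 1), (G.image fun μ => lab μ ((l : ℕ) + 1)).card := Fintype.card_piFinset _
      _ ≤ ∏ _l : Fin (L - 1), f := Finset.prod_le_prod' fun l _ => hslot' _ (by omega)
      _ = f ^ (L - 1) := by simp
      _ ≤ f ^ Lm := Nat.pow_le_pow_right hf (by omega)
  -- assemble
  calc C.card ≤ f ^ Lm * (C.image key).card := Finset.card_le_mul_card_image C _ hfib
    _ ≤ f ^ Lm * ((Lm + 1) * n ^ Lm) := Nat.mul_le_mul_left _ hkey_card
    _ = (Lm + 1) * n ^ Lm * f ^ Lm := by ring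


/-! ## The statements: target `PlanarCellBound` (p596451, verbatim) and the two sub-statements of the split -/

/-- **TARGET `PlanarCellBound`** — VERBATIM the hypothesis of the landed
`FormalLogLinearisation.twoProducts_of_planarCellBound` (p596451): the log-sum engine restricted to ONE weight-order
cell of the tail support.  (A `def` here only for readability of the split; `TwoProducts_of` feeds it to p596451.) -/
def PlanarCellBound : Prop :=
  ∃ a b : ℕ, ∀ (m t : ℕ), 2 ≤ t → ∀ (u v : Fin m → MvPolynomial (Fin 2) ℂ),
    (∀ j, coeff 0 (u j) = 0 ∧ (u j).support.card ≤ t) → (∀ j, coeff 0 (v j) = 0 ∧ (v j).support.card ≤ t) →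
    ∀ (R : Expo → Expo → Prop) (S : Finset Expo),
      (∀ l ∈ S, ∃ ξ : Fin 2 → ℝ, ValidWeight u v ξ ∧ IsStrictTop ξ (logSupport u v) l ∧
        ∀ e ∈ ((Finset.univ.biUnion fun j => (u j).support) ∪ Finset.univ.biUnion fun j => (v j).support),
        ∀ e' ∈ ((Finset.univ.biUnion fun j => (u j).support) ∪ Finset.univ.biUnion fun j => (v j).support),
          (R e e' ↔ wt ξ e ≤ wt ξ e')) →
      S.card ≤ 2 ^ (a * m) * (t + 2) ^ b

/-- **SUB₁ — PLANAR CROSS** (the theory memo's question Q1, typed; planar stand-in for `ExpSum.hyperbolicCross`).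
Every visible point `λ` of `supp D`, `D = Σ_j log(1+u_j) − Σ_j log(1+v_j)`, has a decomposition `λ = Σ_e μ_e·e` over the
tail support with `∏_e (μ_e + 1) ≤ (2m)^c` — polynomially many box points below it, uniformly in the sparsity `t` and in
the size of the tail support.  (`t`-free; for a point with a SINGLETON fibre this is the lifted hyperbolic-cross lemma
with `2m` terms; the content is at planar points whose fibre carries cancellation.) -/
def PlanarCross : Prop :=
  ∃ c : ℕ, ∀ (m : ℕ) (u v : Fin m → MvPolynomial (Fin 2) ℂ),
    (∀ j, coeff 0 (u j) = 0) → (∀ j, coeff 0 (v j) = 0) →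
    ∀ (s : ℕ) (E : Fin s → Expo), Function.Injective E → Set.range E = ↑(tailSupport u v) →
    ∀ l ∈ logVisible u v, ∃ μ : Fin s → ℕ, lam E μ = l ∧ ∏ i, (μ i + 1) ≤ (2 * m) ^ c

/-- **SUB₂ — PLANAR SLOT BOUND** (the fibre-sum RANK step of NOTE §12, typed as a `t`-FREE COUNT; planar stand-in for
`ExpSum.slotRank_card_le`).  Fix tails, an injective enumeration `E` of the tail support, a relation `R` on coordinates
(a weight-order CELL) and an exponent `e ≥ 1`.  Let `D` be a set of coordinates such that every `d ∈ D` carries a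
representative `rep d` in the cross `∏ (rep d_i + 1) ≤ (2m)^c` with `(rep d)_d = e`, whose planar image `Λ_E (rep d)`
is a visible point of `supp D` with a valid witness weight inducing `R`, the planar images being pairwise DISTINCT.
Then `#D ≤ (2m)^{c'}` — independently of `t` and of the size of the tail support.  (In the lifted/dissociated regime the
replacement matrix `(D(Λρ_y + e·E_{d_x}))_{x,y}` is triangular of Hankel rank `≤ 2m`, giving `#D ≤ 2m`; planar-side it
is still triangular with nonzero diagonal — lighter planar points are vanishing FIBRE SUMS — but its entries are fibre
sums with multinomial weights and no rank bound is known: THIS is the open `m`-uniformity.) -/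
def PlanarSlotBound : Prop :=
  ∀ c : ℕ, ∃ c' : ℕ, ∀ (m : ℕ) (u v : Fin m → MvPolynomial (Fin 2) ℂ),
    (∀ j, coeff 0 (u j) = 0) → (∀ j, coeff 0 (v j) = 0) →
    ∀ (s : ℕ) (E : Fin s → Expo), Function.Injective E → Set.range E = ↑(tailSupport u v) →
    ∀ (R : Fin s → Fin s → Prop) (e : ℕ), 1 ≤ e → ∀ (D : Finset (Fin s)) (rep : Fin s → (Fin s → ℕ)),
      (∀ d ∈ D, rep d d = e ∧ ∏ i, (rep d i + 1) ≤ (2 * m) ^ c ∧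
        ∃ ξ : Fin 2 → ℝ, ValidWeight u v ξ ∧ IsStrictTop ξ (logSupport u v) (lam E (rep d)) ∧
          ∀ j j' : Fin s, R j j' ↔ wt ξ (E j) ≤ wt ξ (E j')) →
      Set.InjOn (fun d => lam E (rep d)) ↑D → D.card ≤ (2 * m) ^ c'

/-! ## Registered stubs (OPEN; `sorry` = the two pieces of the split) -/

/-- STUB 1 (crux-half, OPEN): the planar cross. -/
theorem stub_planarCross : PlanarCross := by
  sorry

/-- STUB 2 (crux-half, OPEN — the HARDEST stub): the planar slot bound. -/
theorem stub_planarSlotBound : PlanarSlotBound := by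
  sorry

namespace Registered
/-- registered name of STUB 1 -/
abbrev stub_planarCross : Prop := PlanarCross
/-- registered name of STUB 2 -/
abbrev stub_planarSlotBound : Prop := PlanarSlotBound
end Registered

/-! ## Arithmetic of the split -/

/-- `(j + 2)² ≤ 9 · 2^j`. -/
theorem sq_add_two_le (j : ℕ) : (j + 2) * (j + 2) ≤ 9 * 2 ^ j := by
  induction j with
  | zero => norm_num
  | succ j ih =>
    have hj : j < 2 ^ j := Nat.lt_two_pow_self
    have : (j + 3) * (j + 3) = (j + 2) * (j + 2) + (2 * j + 5) := by ring
    rw [this, pow_succ]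
    omega

/-- `(log₂ m + 2)² ≤ 9m` for `m ≥ 1`. -/
theorem sq_log_add_two_le (m : ℕ) (hm : 1 ≤ m) :
    (Nat.log 2 m + 2) * (Nat.log 2 m + 2) ≤ 9 * m := by
  have h := sq_add_two_le (Nat.log 2 m)
  have h2 : 2 ^ Nat.log 2 m ≤ m := Nat.pow_log_le_self 2 (by omega)
  omega

/-- The cell count of the split is `2^{O(m)}`: with `n = (2m)^c`, `f = (2m)^{c'}`, `L = log₂ n`,
`(L + 1) · n^L · f^L ≤ 2^{9c(1+c+c')·m}` (`m ≥ 1`). -/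
theorem cell_arith (c c' m : ℕ) (hm : 1 ≤ m) :
    (Nat.log 2 ((2 * m) ^ c) + 1) * ((2 * m) ^ c) ^ Nat.log 2 ((2 * m) ^ c) *
        ((2 * m) ^ c') ^ Nat.log 2 ((2 * m) ^ c) ≤ 2 ^ (9 * (c * (1 + c + c')) * m) := by
  set K := Nat.log 2 m + 2 with hK
  set L := Nat.log 2 ((2 * m) ^ c) with hL
  have hmK : 2 * m < 2 ^ K := by
    have h := Nat.lt_pow_succ_log_self (b := 2) (by norm_num) m
    have : 2 ^ K = 2 * 2 ^ (Nat.log 2 m + 1) := by rw [hK, pow_succ]; ring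
    omega
  have hn : (2 * m) ^ c ≤ 2 ^ (c * K) := by
    calc (2 * m) ^ c ≤ (2 ^ K) ^ c := Nat.pow_le_pow_left hmK.le _
      _ = 2 ^ (c * K) := by rw [← pow_mul, mul_comm]
  have hf : (2 * m) ^ c' ≤ 2 ^ (c' * K) := by
    calc (2 * m) ^ c' ≤ (2 ^ K) ^ c' := Nat.pow_le_pow_left hmK.le _
      _ = 2 ^ (c' * K) := by rw [← pow_mul, mul_comm]
  have hLcK : L ≤ c * K := by
    have hn0 : (2 * m) ^ c ≠ 0 := by positivity
    have : L < c * K + 1 :=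
      (Nat.log_lt_iff_lt_pow (by norm_num) hn0).2 (lt_of_le_of_lt hn (Nat.pow_lt_pow_right (by norm_num) (by omega)))
    omega
  have hL1 : L + 1 ≤ 2 ^ (c * K) := by
    have : c * K < 2 ^ (c * K) := Nat.lt_two_pow_self
    omega
  have hKsq : K * K ≤ 9 * m := sq_log_add_two_le m hm
  have h1 : ((2 * m) ^ c) ^ L ≤ (2 ^ (c * K)) ^ (c * K) :=
    (Nat.pow_le_pow_left hn L).trans (Nat.pow_le_pow_right (by positivity) hLcK)
  have h2 : ((2 * m) ^ c') ^ L ≤ (2 ^ (c' * K)) ^ (c * K) :=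
    (Nat.pow_le_pow_left hf L).trans (Nat.pow_le_pow_right (by positivity) hLcK)
  calc (L + 1) * ((2 * m) ^ c) ^ L * ((2 * m) ^ c') ^ L
      ≤ 2 ^ (c * K) * (2 ^ (c * K)) ^ (c * K) * (2 ^ (c' * K)) ^ (c * K) :=
        Nat.mul_le_mul (Nat.mul_le_mul hL1 h1) h2
    _ = 2 ^ (c * K + c * K * (c * K) + c' * K * (c * K)) := by
        rw [← pow_mul, ← pow_mul, ← pow_add, ← pow_add]
    _ ≤ 2 ^ (9 * (c * (1 + c + c')) * m) := by
        refine Nat.pow_le_pow_right (by norm_num) ?_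
        have hK1 : 1 ≤ K := by omega
        have e1 : c * K ≤ c * (K * K) := by nlinarith
        calc c * K + c * K * (c * K) + c' * K * (c * K)
            ≤ c * (K * K) + c * c * (K * K) + c * c' * (K * K) := by nlinarith
          _ = (c * (1 + c + c')) * (K * K) := by ring
          _ ≤ (c * (1 + c + c')) * (9 * m) := Nat.mul_le_mul_left _ hKsq
          _ = 9 * (c * (1 + c + c')) * m := by ring

/-! ## The proved split: `PlanarCross → PlanarSlotBound → PlanarCellBound` -/

/-- **THE SPLIT (proved, no `sorry`).**  `SUB₁ ∧ SUB₂ ⇒ PlanarCellBound`, indeed with a `t`-FREE cell bound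
`2^{9c(1+c+c')·m}·(t+2)^0`: enumerate the tail support, choose for every visible point of the cell family a cross
representative (SUB₁), and run the abstract planar cell count `planarCount_cell` on the representatives — shapes from
the cross, slots from SUB₂, injectivity within a shape from strict-topness (proved there). -/
theorem planarCellBound_of (h₁ : PlanarCross) (h₂ : PlanarSlotBound) : PlanarCellBound := by
  classical
  obtain ⟨c, h₁⟩ := h₁
  obtain ⟨c', h₂⟩ := h₂ c
  refine ⟨9 * (c * (1 + c + c')), 0, fun m t _ht u v hu hv R S hS => ?_⟩
  rcases Nat.eq_zero_or_pos m with hm0 | hmpos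
  · -- `m = 0`: `D = 0`, no visible points
    subst hm0
    have hS0 : S = ∅ := Finset.eq_empty_of_forall_notMem fun l hl => by
      obtain ⟨ξ, -, htop, -⟩ := hS l hl
      exact htop.1 (by simp [logDiff])
    simp [hS0]
  -- enumerate the tail support
  set E₀ : Finset Expo := tailSupport u v with hE₀
  have hE₀eq : ((Finset.univ.biUnion fun j => (u j).support) ∪ Finset.univ.biUnion fun j => (v j).support) = E₀ :=
    rfl
  set s := E₀.card with hs
  set σ := E₀.equivFin with hσ
  let E : Fin s → Expo := fun i => ((σ.symm i : ↥E₀) : Expo)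
  have hEinj : Function.Injective E := fun i i' h => σ.symm.injective (Subtype.ext h)
  have hEmem : ∀ i, E i ∈ E₀ := fun i => (σ.symm i).2
  have hErange : Set.range E = ↑E₀ := by
    ext x
    constructor
    · rintro ⟨i, rfl⟩
      exact hEmem i
    · intro hx
      refine ⟨σ ⟨x, hx⟩, ?_⟩
      simp [E]
  -- cross representatives (SUB₁)
  have hrep : ∀ l ∈ S, ∃ μ : Fin s → ℕ, lam E μ = l ∧ ∏ i, (μ i + 1) ≤ (2 * m) ^ c := by
    intro l hl
    obtain ⟨ξ, hval, htop, -⟩ := hS l hl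
    exact h₁ m u v (fun j => (hu j).1) (fun j => (hv j).1) s E hEinj hErange l ⟨ξ, hval, htop⟩
  choose! rep₀ hrep₀ hcross₀ using hrep
  set C : Finset (Fin s → ℕ) := S.image rep₀ with hC
  have hCcard : C.card = S.card :=
    Finset.card_image_of_injOn fun l hl l' hl' h => by
      have := congrArg (lam E) h
      rwa [hrep₀ l hl, hrep₀ l' hl'] at this
  have hCmem : ∀ μ ∈ C, ∃ l ∈ S, rep₀ l = μ := fun μ hμ => by
    simpa only [hC, Finset.mem_image] using hμ
  -- the cell relation on coordinates
  let R' : Fin s → Fin s → Prop := fun j j' => R (E j) (E j')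
  have hwit : ∀ l ∈ S, ∃ ξ : Fin 2 → ℝ, ValidWeight u v ξ ∧ IsStrictTop ξ (logSupport u v) (lam E (rep₀ l)) ∧
      ∀ j j' : Fin s, R' j j' ↔ wt ξ (E j) ≤ wt ξ (E j') := by
    intro l hl
    obtain ⟨ξ, hval, htop, hRξ⟩ := hS l hl
    refine ⟨ξ, hval, by rw [hrep₀ l hl]; exact htop, fun j j' => ?_⟩
    exact hRξ (E j) (hE₀eq ▸ hEmem j) (E j') (hE₀eq ▸ hEmem j')
  have hf1 : 1 ≤ (2 * m) ^ c' := Nat.one_le_pow _ _ (by omega)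
  have key := planarCount_cell E hEinj (logSupport u v) R' ((2 * m) ^ c) ((2 * m) ^ c') hf1 C
    (fun μ hμ => by
      obtain ⟨l, hl, rfl⟩ := hCmem μ hμ
      obtain ⟨ξ, -, htop, hRξ⟩ := hwit l hl
      exact ⟨hcross₀ l hl, ξ, htop, hRξ⟩)
    (fun e he D rep hD hinj => by
      refine h₂ m u v (fun j => (hu j).1) (fun j => (hv j).1) s E hEinj hErange R' e he D rep
        (fun d hd => ?_) ?_
      · obtain ⟨hdC, hde⟩ := hD d hd
        obtain ⟨l, hl, hlrep⟩ := hCmem _ hdC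
        obtain ⟨ξ, hval, htop, hRξ⟩ := hwit l hl
        rw [hlrep] at htop
        exact ⟨hde, hlrep ▸ hcross₀ l hl, ξ, hval, htop, hRξ⟩
      · intro d hd d' hd' h
        obtain ⟨l, hl, hlrep⟩ := hCmem _ (hD d hd).1
        obtain ⟨l', hl', hlrep'⟩ := hCmem _ (hD d' hd').1
        have hll : l = l' := by
          have h' : lam E (rep d) = lam E (rep d') := h
          rw [← hlrep, ← hlrep', hrep₀ l hl, hrep₀ l' hl'] at h'
          exact h'
        refine hinj hd hd' ?_
        rw [← hlrep, ← hlrep', hll])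
  rw [← hCcard]
  calc C.card ≤ _ := key
    _ ≤ 2 ^ (9 * (c * (1 + c + c')) * m) := cell_arith c c' m hmpos
    _ = 2 ^ (9 * (c * (1 + c + c')) * m) * (t + 2) ^ 0 := by ring

/-! ## The crux by name -/

/-- **`TwoProducts` from the two stubs (kernel-checked composition, no `sorry` of its own):**
`twoProducts_of_planarCellBound` (p596451) ∘ `planarCellBound_of`. -/
theorem TwoProducts_of (h₁ : Registered.stub_planarCross) (h₂ : Registered.stub_planarSlotBound) :
    Summit.ValiantsHypothesis.ValiantsHypothesis.Theses.NewtonUnitEquations.TwoProducts :=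
  twoProducts_of_planarCellBound (planarCellBound_of h₁ h₂)

/-- The line closed modulo its two stubs (uses the `sorry`s above; for the record only). -/
theorem twoProducts_holds : Summit.ValiantsHypothesis.ValiantsHypothesis.Theses.NewtonUnitEquations.TwoProducts :=
  TwoProducts_of stub_planarCross stub_planarSlotBound


/-! ## What SUB₁ alone gives: a quasi-polynomial cell bound (proved) -/

/-- **SUB₁ alone ⇒ a QUASI-POLYNOMIAL cell bound** `#S ≤ (L+1)·n^L·(2mt)^L`, `n = (2m)^c`, `L = log₂ n` (the trivial
slot bound `#D ≤ #tail support ≤ 2mt` in `planarCount_cell`): the planar cross already replaces the exponent `m` of the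
trivial count `#supp(∏(1+u) − ∏(1+v)) ≤ 2(t+1)^m` by `O(c² log² m)`; SUB₂ is exactly what removes the last `t^{log m}`.
-/
theorem quasiPolyCell_of_planarCross (h₁ : PlanarCross) :
    ∃ c : ℕ, ∀ (m t : ℕ) (u v : Fin m → MvPolynomial (Fin 2) ℂ),
      (∀ j, coeff 0 (u j) = 0 ∧ (u j).support.card ≤ t) → (∀ j, coeff 0 (v j) = 0 ∧ (v j).support.card ≤ t) →
      ∀ (R : Expo → Expo → Prop) (S : Finset Expo),
        (∀ l ∈ S, ∃ ξ : Fin 2 → ℝ, ValidWeight u v ξ ∧ IsStrictTop ξ (logSupport u v) l ∧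
          ∀ e ∈ tailSupport u v, ∀ e' ∈ tailSupport u v, (R e e' ↔ wt ξ e ≤ wt ξ e')) →
        S.card ≤ (Nat.log 2 ((2 * m) ^ c) + 1) * ((2 * m) ^ c) ^ Nat.log 2 ((2 * m) ^ c) *
          (2 * m * t) ^ Nat.log 2 ((2 * m) ^ c) := by
  classical
  obtain ⟨c, h₁⟩ := h₁
  refine ⟨c, fun m t u v hu hv R S hS => ?_⟩
  rcases Nat.eq_zero_or_pos m with hm0 | hmpos
  · subst hm0
    have hS0 : S = ∅ := Finset.eq_empty_of_forall_notMem fun l hl => by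
      obtain ⟨ξ, -, htop, -⟩ := hS l hl
      exact htop.1 (by simp [logDiff])
    simp [hS0]
  set E₀ : Finset Expo := tailSupport u v with hE₀
  -- the tail support has at most `2mt` points
  have hEcard : E₀.card ≤ 2 * m * t := by
    calc E₀.card ≤ (Finset.univ.biUnion fun j => (u j).support).card +
          (Finset.univ.biUnion fun j => (v j).support).card := Finset.card_union_le _ _
      _ ≤ (∑ j : Fin m, ((u j).support).card) + ∑ j : Fin m, ((v j).support).card :=
          Nat.add_le_add Finset.card_biUnion_le Finset.card_biUnion_le
      _ ≤ (∑ _j : Fin m, t) + ∑ _j : Fin m, t :=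
          Nat.add_le_add (Finset.sum_le_sum fun j _ => (hu j).2) (Finset.sum_le_sum fun j _ => (hv j).2)
      _ = 2 * m * t := by simp; ring
  set s := E₀.card with hs
  set σ := E₀.equivFin with hσ
  let E : Fin s → Expo := fun i => ((σ.symm i : ↥E₀) : Expo)
  have hEinj : Function.Injective E := fun i i' h => σ.symm.injective (Subtype.ext h)
  have hEmem : ∀ i, E i ∈ E₀ := fun i => (σ.symm i).2
  have hErange : Set.range E = ↑E₀ := by
    ext x
    constructor
    · rintro ⟨i, rfl⟩
      exact hEmem i
    · intro hx
      refine ⟨σ ⟨x, hx⟩, ?_⟩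
      simp [E]
  have hrep : ∀ l ∈ S, ∃ μ : Fin s → ℕ, lam E μ = l ∧ ∏ i, (μ i + 1) ≤ (2 * m) ^ c := by
    intro l hl
    obtain ⟨ξ, hval, htop, -⟩ := hS l hl
    exact h₁ m u v (fun j => (hu j).1) (fun j => (hv j).1) s E hEinj hErange l ⟨ξ, hval, htop⟩
  choose! rep₀ hrep₀ hcross₀ using hrep
  set C : Finset (Fin s → ℕ) := S.image rep₀ with hC
  have hCcard : C.card = S.card :=
    Finset.card_image_of_injOn fun l hl l' hl' h => by
      have := congrArg (lam E) h
      rwa [hrep₀ l hl, hrep₀ l' hl'] at this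
  have hCmem : ∀ μ ∈ C, ∃ l ∈ S, rep₀ l = μ := fun μ hμ => by
    simpa only [hC, Finset.mem_image] using hμ
  let R' : Fin s → Fin s → Prop := fun j j' => R (E j) (E j')
  -- empty tail support: no visible points at all (a visible point has a representative, `Fin 0 → ℕ` gives `0 ∉ supp D`)
  rcases Nat.eq_zero_or_pos s with hs0 | hspos
  · have hS0 : S = ∅ := Finset.eq_empty_of_forall_notMem fun l hl => by
      obtain ⟨ξ, hval, htop, -⟩ := hS l hl
      have hl0 : l = 0 := by
        rw [← hrep₀ l hl]
        unfold lam
        have hemp : IsEmpty (Fin s) := by rw [hs0]; infer_instance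
        have : (Finset.univ : Finset (Fin s)) = ∅ := Finset.univ_eq_empty_iff.2 hemp
        rw [this, Finset.sum_empty]
      apply htop.1
      rw [hl0]
      simp [logDiff, logCoeff]
    simp [hS0]
  have key := planarCount_cell E hEinj (logSupport u v) R' ((2 * m) ^ c) s hspos C
    (fun μ hμ => by
      obtain ⟨l, hl, rfl⟩ := hCmem μ hμ
      obtain ⟨ξ, -, htop, hRξ⟩ := hS l hl
      exact ⟨hcross₀ l hl, ξ, by rw [hrep₀ l hl]; exact htop, fun j j' => hRξ (E j) (hEmem j) (E j') (hEmem j')⟩)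
    (fun e _ D _ _ _ => by
      calc D.card ≤ (Finset.univ : Finset (Fin s)).card := Finset.card_le_card (Finset.subset_univ D)
        _ = s := by simp)
  rw [← hCcard]
  refine key.trans ?_
  gcongr

/-! ## Calibration rungs at `m = 1` (both stubs' bodies hold; the engine is known there — typing sanity, not a
witness of weakness) -/

/-- **At most ONE visible point of a cell family lies in the tail support** (all `m`): two distinct tail exponents
that are both in `supp D` are `R`-comparable, and the `R`-heavier one refutes the strict top of the other. -/
theorem eq_of_visible_mem_tailSupport (u v : Fin m → MvPolynomial (Fin 2) ℂ) (R : Expo → Expo → Prop)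
    {l l' : Expo} (hl : l ∈ tailSupport u v) (hl' : l' ∈ tailSupport u v) {ξ ξ' : Fin 2 → ℝ}
    (htop : IsStrictTop ξ (logSupport u v) l) (htop' : IsStrictTop ξ' (logSupport u v) l')
    (hR : ∀ e ∈ tailSupport u v, ∀ e' ∈ tailSupport u v, (R e e' ↔ wt ξ e ≤ wt ξ e'))
    (hR' : ∀ e ∈ tailSupport u v, ∀ e' ∈ tailSupport u v, (R e e' ↔ wt ξ' e ≤ wt ξ' e')) : l = l' := by
  by_contra hne
  rcases le_total (wt ξ' l') (wt ξ' l) with hle | hle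
  · have := htop'.2 l htop.1 hne
    linarith
  · have hle2 : wt ξ l ≤ wt ξ l' := (hR l hl l' hl').1 ((hR' l hl l' hl').2 hle)
    have := htop.2 l' htop'.1 (Ne.symm hne)
    linarith

/-- For `m = 1` every visible point of `supp D` is a tail exponent (`…LogSumEngineOne.logVisible_subset_support_sub`:
it is a monomial of `u − v`). -/
theorem logVisible_subset_tailSupport_one (u v : Fin 1 → MvPolynomial (Fin 2) ℂ)
    (hu0 : ∀ j, coeff 0 (u j) = 0) (hv0 : ∀ j, coeff 0 (v j) = 0) :
    logVisible u v ⊆ ↑(tailSupport u v) := by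
  classical
  intro l hl
  have h := logVisible_subset_support_sub u v (hu0 0) (hv0 0) hl
  have h2 := MvPolynomial.support_sub _ (u 0) (v 0) h
  simp only [Finset.mem_union] at h2
  simp only [tailSupport, Finset.coe_union, Set.mem_union, Finset.mem_coe, Finset.mem_biUnion, Finset.mem_univ,
    true_and]
  rcases h2 with h2 | h2
  · exact Or.inl ⟨0, h2⟩
  · exact Or.inr ⟨0, h2⟩

/-- **RUNG: SUB₁ at `m = 1`** (with `c = 1`): a visible point is a tail exponent `E_i = Λ_E(e_i)`, and
`∏ ((e_i)_j + 1) = 2 ≤ 2·1`. -/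
theorem planarCross_one (u v : Fin 1 → MvPolynomial (Fin 2) ℂ)
    (hu0 : ∀ j, coeff 0 (u j) = 0) (hv0 : ∀ j, coeff 0 (v j) = 0)
    (s : ℕ) (E : Fin s → Expo) (_hE : Function.Injective E) (hrange : Set.range E = ↑(tailSupport u v)) :
    ∀ l ∈ logVisible u v, ∃ μ : Fin s → ℕ, lam E μ = l ∧ ∏ i, (μ i + 1) ≤ (2 * 1) ^ 1 := by
  classical
  intro l hl
  have hlE : l ∈ Set.range E := by rw [hrange]; exact logVisible_subset_tailSupport_one u v hu0 hv0 hl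
  obtain ⟨i, rfl⟩ := hlE
  refine ⟨Pi.single i 1, lam_single E i, ?_⟩
  rw [Finset.prod_eq_single i (fun j _ hj => by simp [hj]) (fun h => absurd (Finset.mem_univ i) h)]
  simp

/-- **RUNG: SUB₂ at `m = 1`** (with `c' = 0`, any `c`): the planar images `Λ_E(rep d)` are visible points of ONE cell and,
for `m = 1`, tail exponents, so there is at most one of them (`eq_of_visible_mem_tailSupport`); the images being
distinct, `#D ≤ 1 = (2·1)^0`. -/
theorem planarSlotBound_one (c : ℕ) (u v : Fin 1 → MvPolynomial (Fin 2) ℂ)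
    (hu0 : ∀ j, coeff 0 (u j) = 0) (hv0 : ∀ j, coeff 0 (v j) = 0)
    (s : ℕ) (E : Fin s → Expo) (_hE : Function.Injective E) (hrange : Set.range E = ↑(tailSupport u v))
    (R : Fin s → Fin s → Prop) (e : ℕ) (_he : 1 ≤ e) (D : Finset (Fin s)) (rep : Fin s → (Fin s → ℕ))
    (hD : ∀ d ∈ D, rep d d = e ∧ ∏ i, (rep d i + 1) ≤ (2 * 1) ^ c ∧
      ∃ ξ : Fin 2 → ℝ, ValidWeight u v ξ ∧ IsStrictTop ξ (logSupport u v) (lam E (rep d)) ∧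
        ∀ j j' : Fin s, R j j' ↔ wt ξ (E j) ≤ wt ξ (E j'))
    (hinj : Set.InjOn (fun d => lam E (rep d)) ↑D) : D.card ≤ (2 * 1) ^ 0 := by
  classical
  have hEmem : ∀ i, E i ∈ tailSupport u v := fun i => by
    have : E i ∈ Set.range E := ⟨i, rfl⟩
    rw [hrange] at this
    exact this
  -- the cell relation on the tail support induced by `R`
  have hsurj : ∀ x ∈ tailSupport u v, ∃ i, E i = x := fun x hx => by
    have : x ∈ Set.range E := by rw [hrange]; exact hx
    exact this
  rw [show (2 * 1) ^ 0 = 1 from rfl, Finset.card_le_one]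
  intro d hd d' hd'
  obtain ⟨-, -, ξ, hval, htop, hRξ⟩ := hD d hd
  obtain ⟨-, -, ξ', hval', htop', hRξ'⟩ := hD d' hd'
  have hvis : lam E (rep d) ∈ logVisible u v := ⟨ξ, hval, htop⟩
  have hvis' : lam E (rep d') ∈ logVisible u v := ⟨ξ', hval', htop'⟩
  have hmem := logVisible_subset_tailSupport_one u v hu0 hv0 hvis
  have hmem' := logVisible_subset_tailSupport_one u v hu0 hv0 hvis'
  -- transport `R` to the tail support through the enumeration
  let RT : Expo → Expo → Prop := fun x y => ∃ i i', E i = x ∧ E i' = y ∧ R i i'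
  have hRT : ∀ (ζ : Fin 2 → ℝ), (∀ j j' : Fin s, R j j' ↔ wt ζ (E j) ≤ wt ζ (E j')) →
      ∀ x ∈ tailSupport u v, ∀ y ∈ tailSupport u v, (RT x y ↔ wt ζ x ≤ wt ζ y) := by
    intro ζ hζ x hx y hy
    obtain ⟨i, rfl⟩ := hsurj x hx
    obtain ⟨i', rfl⟩ := hsurj y hy
    constructor
    · rintro ⟨k, k', hk, hk', hRk⟩
      rw [_hE hk, _hE hk'] at hRk
      exact (hζ i i').1 hRk
    · intro hle
      exact ⟨i, i', rfl, rfl, (hζ i i').2 hle⟩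
  exact hinj hd hd' (eq_of_visible_mem_tailSupport u v RT hmem hmem' htop htop' (hRT ξ hRξ) (hRT ξ' hRξ'))

end Summit.ValiantsHypothesis.ValiantsHypothesis.Cruxes.TwoProducts.PlanarCell

end
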